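import Mathlib
import HarnessLib
import HarnessLib.Audit
import Summits.BirchSwinnertonDyer.Statement
import Summits.BirchSwinnertonDyer.BirchSwinnertonDyer.Theorems.SqueezeAssembly
import HarnessLib.Audit.Status.Attr

/-!
Route: Squeeze

# Route Squeeze — BirchSwinnertonDyer: squeeze r_MW ≤ r_an ≤ r_MW + 1 and match parities

## Thesis X (it suffices to show)
Three inequalities on the Mordell–Weil rank r_MW and the analytic rank r_an of every elliptic curve
E/ℚ:
(UB) r_MW ≤ r_an, (LB+1) r_an ≤ r_MW + 1, (PAR) r_MW ≡ r_an (mod 2). X = UB ∧ LB+1 ∧ PAR is the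
target item
SqueezeThesis; its conjuncts are the ranked cruxes SqueezeUBR2 (UB; the item shared verbatim with
route
HigherGrossZagier), SqueezeLBplusOne and SqueezeParity, and the rank-2 crux is the first open case
of LB+1,
SqueezeOnePoint (r_an ≥ 2 ⇒ r_MW ≥ 1: one rational point of infinite order in analytic rank ≥ 2). No
idea card:
this is the survey's elementary accounting frame against which the SelmerRank / PAdicOrder /
HigherGrossZagier
cruxes dedup (refuter grade KNOWN: X ⇔ BSD-rank; the route partitions the conjecture into its three
mechanisms, it
does not reduce it).
Lean: `(∀ (W : WeierstrassCurve ℚ) [W.IsElliptic], W.mordellWeilRank ≤ W.analyticRank) ∧ (∀ (W :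
WeierstrassCurve ℚ) [W.IsElliptic], W.analyticRank ≤ W.mordellWeilRank + 1) ∧ (∀ (W :
WeierstrassCurve ℚ) [W.IsElliptic], Even W.mordellWeilRank ↔ Even W.analyticRank)`

## Assembly X → BirchSwinnertonDyer
Arithmetic in ℕ: a ≤ b ≤ a + 1 and a ≡ b (mod 2) force a = b (unfold BirchSwinnertonDyer =
Literature.BSDRankConjecture; Nat.even_iff; omega). DECIDING THEOREM (D-0027 §2.1, certified native,
axioms
propext / Classical.choice / Quot.sound): `theorem closes (hUB : SqueezeUBR2) (hLB :
SqueezeLBplusOne)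
(hPAR : SqueezeParity) : BirchSwinnertonDyer`. The conjunction form X → BirchSwinnertonDyer is the
assembly item
Assembly (PROVED: Literature.BSD.squeeze_assembly, Theorems/SqueezeAssembly.lean); the target X is
reached from
the cruxes by the support glue SqueezeThesisOfCruxes (conjunction introduction). No named Literature
fact is a
hypothesis of `closes` or of any item.

Rationale: WHY THIS LINE. It separates the three genuinely different mechanisms behind r_an = r_MW and gives
refuters a
computable target. UB is what Euler systems bound (Kolyvagin1990; Kato2004 Thm 14.2 / 18.4: known
when r_an ≤ 1,
and for r_an ≥ 2 only r_MW ≤ corank Sel_p∞ ≤ ord_T L_p, with ord_T L_p ≤ ord_{s=1} L open = route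
PAdicOrder);
LB+1 is "where do rational points come from" (GrossZagier1986 Thm I.6.3 + Kolyvagin1990 give it when
r_an ≤ 1 via
Heegner points; nothing constructs even ONE point of infinite order when r_an ≥ 2, hence crux #2);
PAR for r_MW
(not the Selmer rank) is open and, given p-parity (DokchitserDokchitserAnnals2010 Thm 1.4) and w(E)
= (−1)^{r_an},
equivalent to evenness of corank Ш[p^∞] for one p (Cor 4.20; Nekovar2006 §12). All three conjuncts
hold when
r_an ≤ 1 (tree fact
Literature.NumberTheory.EllipticCurves.rank_eq_analyticRank_of_analyticRank_le_one). No other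
area is imported, by design: this is the elementary frame the SelmerRank / PAdicOrder /
HigherGrossZagier cruxes
dedup against (UB is one shared item with HigherGrossZagier); novelty grade known (refuter route
review
2026-08-15). CONE: no route decl names a cite-only constant (`route show` rev 7: staffable, 0
unproved deps among
24 project constants; READY).
needs-fact: WeierstrassCurve.hasEntireLFunction_rat — GENUINELY NEEDED, tier-0 Literature debt
(modularity ⇒
entire continuation of L(E,s): Wiles1995, BCDTJAMS2001 Thm A; reduced in tree to
Literature.NumberTheory.EllipticCurves.ModularForms.exists_isNewformOf by
WeierstrassCurve.hasEntireLFunction_rat_of_exists_isNewformOf). It cannot be routed around: it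
enters the MODULE
cone through Summits/BirchSwinnertonDyer/BirchSwinnertonDyer/Statement.lean itself (analyticRank :=
analyticOrderNatAt of the chosen entire continuation lives in the same file and is junk 0 without
it, so UB is
unprovable for a rank ≥ 1 curve until the continuation exists), hence it is owed by every eventual
PROOF of UB /
LB+1 / PAR on every BSD route — never a hypothesis of an item or of `closes`. The support marker
EntireContinuation (stmt-1068; body the unfolded statement, Iff.rfl with the fact) closes in one
line once
WeierstrassCurve.hasEntireLFunction_rat_holds lands.
RANKED CRUXES. #2 SqueezeOnePoint — 2 ≤ r_an → 1 ≤ r_MW (why it might fail: an E with r_an ≥ 2, E(ℚ)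
finite and
Ш[p^∞] infinite is excluded by nothing known — Heegner points are torsion there, generalised Kato /
diagonal
classes give Selmer classes not points, plectic points are conjectural; GrossZagier1986,
Kolyvagin1990,
arXiv:1809.09066 Thm A, arXiv:2104.12575 p3,
Literature.Barriers.BirchSwinnertonDyer.HeegnerPointBarrier).
#3 SqueezeLBplusOne — r_an ≤ r_MW + 1 (fails iff some E has r_an ≥ r_MW + 2; p-parity rescues only
odd r_an and
only if Ш[p^∞] is finite for some p, DokchitserDokchitserAnnals2010 Cor 4.20). #4 SqueezeUBR2 — r_MW
≤ r_an,
shared with HigherGrossZagier (fails iff an excess-rank curve exists, forced r_an ≥ 2, r_MW ≥ 3;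
Kato2004 Thm
18.4, SkinnerUrban2014, Literature.Barriers.BirchSwinnertonDyer.SelmerRankBarrier). #5 SqueezeParity
— Even r_MW
↔ Even r_an (fails iff corank Ш[p^∞] is odd; DokchitserDokchitserAnnals2010 Thm 1.4 + Cor 4.20,
Literature.Barriers.BirchSwinnertonDyer.mordellWeilRank_mod_two_eq_iff_even_shaCorank).
SUPPORT. SqueezeThesisOfCruxes = the glue UB → LB+1 → PAR → X (conjunction introduction, provable
now; planner
Sketch.lean rc 0); SqueezeNegExcessRank = ¬UB (∃ E, r_an < r_MW), the finitely certifiable kill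
switch;
EntireContinuation = the needs-fact marker above; target SqueezeThesis = X; assembly Assembly = X →
BirchSwinnertonDyer (proved, Literature.BSD.squeeze_assembly). SHAPE DEBT (operator-only; re-probed
by badge repair g3 on 2026-08-16 after both assembly twins had been
closed): the ledger still carries seven incident-era byte-identical twins — Assembly2 (stmt-0493 ≡
Assembly
stmt-0142; BOTH closed·proved by Literature.BSD.squeeze_assembly since 03:21Z / 03:26Z) and
SqueezeThesisR2 /
SqueezeOnePointR2 / SqueezeLBplusOneR2 / SqueezeParityR2 / SqueezeNegExcessRankR2 / SqueezeUB (≡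
target / cruxes /
kill switch / crux SqueezeUBR2) — so the file shows 16 items and 2 assembly-kind items where the
intended state is
9 items with exactly one assembly. Planner verbs cannot get there: `--drop Assembly2` → "the
assembly item cannot
be dropped" (even now that it is closed), `--retriage` refuses the assembly kind, and every other
item-changing
edit (the six support drops, g3 05:17Z) is bounced by the projection "after this edit the route
would violate
D-0019 — route.multi-assembly: 2 assembly items". One operator command clears it: `ledger route edit
route-BirchSwinnertonDyer-Squeeze --drop Assembly2 --drop SqueezeThesisR2 --drop SqueezeOnePointR2
--drop
SqueezeLBplusOneR2 --drop SqueezeParityR2 --drop SqueezeNegExcessRankR2 --drop SqueezeUB` (target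
state
self-checked: planner Route.md / route.json, `ledger route check` rc 0; Sketch.lean rc 0). Nothing
mathematical
depends on it: `closes`, READY and staffable (0 unproved deps among 24 constants) are unaffected,
and
route.target-unreachable is already cleared by SqueezeThesisOfCruxes (stmt-14214).
KILL CRITERIA. SqueezeNegExcessRank proved (one curve with r_MW > r_an: k independent points
exhibited exactly and
L^{(m)}(E,1) ≠ 0 certified by interval arithmetic for some m < k, BCDTJAMS2001 +
CremonaAlgorithms1997 §2.13)
refutes UB, X and BirchSwinnertonDyer itself → close --reason refuted:SqueezeUBR2. A certified curve
with r_an ≥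
r_MW + 2 refutes LB+1 (and BSD) but is not certifiable numerically once r_an ≥ 4 (exact vanishing of
L-derivatives is undecidable by computation,
Literature.Barriers.BirchSwinnertonDyer.NumericalVanishingBarrier), so
LB+1 can only die via theory. Pivot: if SelmerRank's Selmer-level upper bound (corank Sel_p∞ ≤ r_an)
is refuted,
demote this route (UB then has no mechanism left); if SelmerRank or PAdicOrder closes, this frame is
mooted
(superseded), not refuted.
NOT DECOMPOSED YET. How #2 could be attacked (Darmon's Stark–Heegner points, DarmonRotger2017
diagonal cycles in
rank 2, plectic points arXiv:2104.12575) — a glued split of SqueezeOnePoint only once a candidate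
construction is
typed; PAR via finiteness / evenness of Ш[p^∞] (that is SelmerRank's Ш-corank item, not re-filed
here); the r_an ≤
1 cases of UB / LB+1 / PAR (GZK, a Literature fact, enters a proof as hypothesis-discharge, not as
items);
quantitative or averaged UB (BhargavaSkinnerZhang2014-type statements are Literature, not this
route). Two layers
only: helper lemmas ride with --supports.
CHEAPEST FALSIFIER. A database lookup, already negative: in Cremona's tables / LMFDB (every E/ℚ of
conductor <
500000; CremonaAlgorithms1997, arXiv:1010.2431 for N < 5000 with full BSD when r ≤ 1) no curve has
(number of
independent rational points found) > (index of the first numerically non-vanishing derivative of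
L(E,s) at s = 1);
a single such curve, with the non-vanishing certified by interval arithmetic, kills UB, X and the
summit. The
cheapest THEORETICAL check is the r_an ≤ 1 regime, where all three conjuncts are theorems
(GrossZagier1986 +
Kolyvagin1990) — passed.
NUMBERS. BhargavaSkinnerZhang2014 (arXiv:1407.1826) Thms 1–2: r_MW = r_an ≤ 1, hence X, for ≥ 66.48%
of E/ℚ ordered
by height; Cremona / LMFDB: r_MW = r_an (numerically) for all E of conductor < 500000, ranks 0–4
occur (first
rank-4 conductor 234446); analytic rank is upper-certifiable (L^{(m)}(E,1) ≠ 0) but exact vanishing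
is provable
only for r_an ≤ 3 via Gross–Zagier (e.g. 5077a: r_an = 3).
SOURCES. BirchSwinnertonDyer1965; Wiles2000 / Clay2006 (statement); GrossZagier1986; Kolyvagin1990;
Kato2004;
SkinnerUrban2014; DokchitserDokchitserAnnals2010; Nekovar2006; BhargavaSkinnerZhang2014;
CremonaAlgorithms1997;
BCDTJAMS2001; Wiles1995; arXiv:1809.09066 (CastellaHsieh2022); arXiv:2104.12575; arXiv:1010.2431;
DarmonRotger2017.

Novelty: Nearest prior art (lit search/frontier/read, 2026-08-14): the squeeze r_MW ≤ r_an ≤ r_MW+1 & parity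
⇒ equality is bookkeeping already implicit in GZK (GrossZagier1986, Kolyvagin1990: all three
conjuncts when r_an ≤ 1; tree fact
Literature.NumberTheory.EllipticCurves.rank_eq_analyticRank_of_analyticRank_le_one) and in
BhargavaSkinnerZhang2014 (arXiv:1407.1826 p3: Selmer averages + p-converse +
DokchitserDokchitserAnnals2010 parity ⇒ r_MW = r_an ≤ 1 for ≥ 66.48% of E); PAR-for-r_MW ⇔ even
Ш-corank is DokchitserDokchitserAnnals2010 Cor 4.20 (tree:
Literature.Barriers.BirchSwinnertonDyer.mordellWeilRank_mod_two_eq_iff_even_shaCorank); the rank-≥2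
point problem (OnePoint) is the 'long-standing open problem' of arXiv:2104.12575 p3, attacked by
generalised Kato classes (paper:doi-10-1186-s40687-016-0074-9 p25; CastellaHsieh2022 =
arXiv:1809.09066 Thm A), which give Selmer classes, not points; Darmon (paper:doi-10-4171-022-2-15
p13): 'almost nothing is known when r > 1'. Delta: none in mechanism — an accounting frame, expected
grade known/variant. What it adds is organisational: (i) OnePoint `2 ≤ r_an → 1 ≤ r_MW` isolated as
a Mordell–Weil-level (not Selmer-level) crux that every point construction beyond Heegner points
must pass; (ii) PAR stated for r_MW without root numbers, so it dedups with SelmerRank's Ш-corank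
item; (iii) ¬UB staffed as a finitely certifiable kill switch. No cross-field import.  [refs: 1407.1826, 2104.12575, 1809.09066, paper:doi-10-1186-s40687-016-0074-9, paper:doi-10-4171-022-2-15, GrossZagier1986, Kolyvagin1990, BhargavaSkinnerZhang2014, DokchitserDokchitserAnnals2010, CastellaHsieh2022]

Barriers (technique_class: rank-squeeze, euler-systems, heegner-points, parity): (UB = Euler systems; LB+1/OnePoint = point construction; PAR = parity.)
Literature.Barriers.BirchSwinnertonDyer.HeegnerPointBarrier — hits OnePoint/LB+1 squarely (Heegner
points torsion once r_an ≥ 2); NOT evaded: the bet is a point construction outside the Heegner class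
(Stark–Heegner/plectic arXiv:2104.12575, diagonal cycles; none yields points yet).
Literature.Barriers.BirchSwinnertonDyer.SelmerRankBarrier — hits UB and PAR: known bounds/parities
for r_MW pass through Sel_p∞ and need Ш-corank 0 (resp. even); not evaded: UB via Kato/Skinner–Urban
+ PAdicOrder inherits it, PAR is exactly 'Ш-corank even'
(Literature.Barriers.BirchSwinnertonDyer.mordellWeilRank_mod_two_eq_iff_even_shaCorank).
Literature.Barriers.BirchSwinnertonDyer.DokchitserDokchitser2011_rankMod_notSumOfLocalInvariants —
respected: local data serve parity (PAR) only; UB, LB+1 are not local-formula claims.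
Literature.Barriers.BirchSwinnertonDyer.FunctionalEquationSeesOnlyParity — respected: the functional
equation enters only via even_analyticRank_iff (PAR).
Literature.Barriers.BirchSwinnertonDyer.PAdicFunctionalEquationSeesOnlyParity — touches UB only via
the PAdicOrder import (ord_T L_p vs r_an); no sign claim here.
Literature.Barriers.BirchSwinnertonDyer.NumericalVanishingBarrier — kill criteria: ¬UB (0257) needs
only UPPER certification L^(m)(E,1) ≠ 0 (evades); refuting LB+1 at r_an ≥ 4 needs exact vanishing
(blocked).
(p-adic-height/exceptional-zero/anticyclotomic/descent-defect barriers: PAdicOrder and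

Novelty grade: known — route-review grade (refuter-rreview1-Squeeze-0, 2026-08-15): KNOWN. The thesis X = UB ∧ LB+1 ∧ PAR is logically EQUIVALENT to BSD-rank (X → BSD = Literature.BSD.squeeze_assembly p3368; BSD → X three lines, both re-verified in my W.lean rc0), so the route reduces nothing: it partitions the conjecture (refuter refuter-rreview1-BirchSwinnertonDyer-Squeeze-95f8d6be-0, 2026-08-15T18:27:57Z; prior: GrossZagier1986 Thm I.6.3 + Kolyvagin1990 (all three conjuncts for r_an ≤ 1; tree: Literature.NumberTheory.EllipticCurves.rank_eq_analyticRank_of_analyticRank_le_one), DokchitserDokchitserAnnals2010 Thm 1.4 / Cor 4.20 p27 (PAR for r_MW ⇔ even Ш-corank; tree: Literature.Barriers.BirchSwinnertonDyer.mordellWeilRank_mod_two_eq_iff_even_shaCorank), arXiv:1407.1826 BhargavaSkinnerZhang2014 p3 Thms 1-2 )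

History (route lifecycle, newest last):
- 2026-08-16T14:43:05Z · LINT AUTOFIX route.multi-assembly: kept Assembly, dropped Assembly2 (gate:hygiene)
- 2026-08-26T16:12:16Z · DORMANT — reconciler: no traction for 6.2 d (last activity item-evidence-added at 2026-08-20T10:52:23Z); parked, not closed — `ledger route dormant route-BirchSwinnertonD (operator:999:4169656)
- 2026-08-29T01:45:25Z · REACTIVATED — reconciler: reactivated — activity item-evidence-added at 2026-08-29T00:35:58Z after parking at 2026-08-26T16:12:16Z (operator:999:1286444)

sub-problem: BirchSwinnertonDyer · status: open · opened planner-BirchSwinnertonDyer-Survey-0 2026-08-13T06:05:31Z · rev 9 · ledger route-BirchSwinnertonDyer-Squeeze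
GENERATED by the gate from the ledger (D-0016/17). Provers cite these decls: `theorem foo : Summit.BirchSwinnertonDyer.BirchSwinnertonDyer.Theses.Squeeze.<Decl> := …` in Summits/BirchSwinnertonDyer/BirchSwinnertonDyer/Theorems/<Name>.lean.
-/

namespace Summit.BirchSwinnertonDyer.BirchSwinnertonDyer.Theses.Squeeze

open scoped BigOperators Topology Manifold Classical MeasureTheory ProbabilityTheory Matrix InnerProductSpace ComplexConjugate ContinuousMap
open Filter Set Function TopologicalSpace MeasureTheory

attribute [summit_statement] _root_.BirchSwinnertonDyer

open Literature

/-! Retired items kept as plain definitions (history; not obligations of this route): landed proofs / closed glue still name them. -/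

/-- retired stmt-BirchSwinnertonDyer-0493 (dropped, gen None) — proved by Literature.BSD.squeeze_assembly. -/
def Assembly2 : Prop :=
  ((∀ (W : WeierstrassCurve ℚ) [W.IsElliptic], W.mordellWeilRank ≤ W.analyticRank) ∧ (∀ (W : WeierstrassCurve ℚ) [W.IsElliptic], W.analyticRank ≤ W.mordellWeilRank + 1) ∧ (∀ (W : WeierstrassCurve ℚ) [W.IsElliptic], Even W.mordellWeilRank ↔ Even W.analyticRank)) → BirchSwinnertonDyer

/-- item stmt-BirchSwinnertonDyer-0141 · target · rank 0 · open · by planner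
why it might fail: X ⇔ BSD-rank itself (Assembly proved: Literature.BSD.squeeze_assembly; BSD ⇒ X trivially), so X is exactly as hard as the summit: it fails iff some E/ℚ has excess rank (r_MW > r_an), rank deficit ≥ 2, or odd Ш-corank; every conjunct is open as soon as r_an ≥ 2 (Darmon ICM p13).
sources: Literature.BSD.squeeze_assembly (Theorems/SqueezeAssembly.lean, p3368), Literature.NumberTheory.EllipticCurves.rank_eq_analyticRank_of_analyticRank_le_one (GZK: all three conjuncts for r_an ≤ 1; Darmon2004 Thm 3.22), paper:doi-10-4171-022-2-15 p13 ('almost nothing is known about this conjecture when r > 1'), BhargavaSkinnerZhang2014 = paper:arxiv-1407.1826 p3 (X for ≥ 66.48% of E by height)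
Thesis X of route Squeeze: upper bound, lower bound up to one, and parity agreement of Mordell–Weil
and analytic ranks. Kato2004/Kolyvagin1990 (UB in r_an ≤ 1), GrossZagier1986 (LB),
DokchitserDokchitser2010 + Nekovar2006 §12 (parity). imports: Summits.BirchSwinnertonDyer.Statement,
Literature.NumberTheory.EllipticCurves.{Selmer,Sha,Heights,GaloisAction,Tamagawa,BSDInvariants}
(routes/Sketch.lean, lean check rc 0 on 2026-08-13). -/
@[route_item "route-BirchSwinnertonDyer-Squeeze"]
def SqueezeThesis : Prop :=
  (∀ (W : WeierstrassCurve ℚ) [W.IsElliptic], W.mordellWeilRank ≤ W.analyticRank) ∧ (∀ (W : WeierstrassCurve ℚ) [W.IsElliptic], W.analyticRank ≤ W.mordellWeilRank + 1) ∧ (∀ (W : WeierstrassCurve ℚ) [W.IsElliptic], Even W.mordellWeilRank ↔ Even W.analyticRank)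

/-- item stmt-BirchSwinnertonDyer-0143 · crux · rank 2 · open · by planner
why it might fail: False iff some E/ℚ with r_an ≥ 2 has E(ℚ) finite (then Ш[p^∞] infinite at Skinner–Urban primes; nothing known excludes it). Nothing gives a point once L(E,1)=L'(E,1)=0: Heegner points are torsion, generalised Kato classes are Selmer classes not points, plectic points are conjectural.
sources: Literature.Barriers.BirchSwinnertonDyer.HeegnerPointBarrier (Literature.Barriers.BirchSwinnertonDyer.heegnerPointBarrier_of_facts), GrossZagier1986 Thm I.6.3 + Kolyvagin1990 (book:cornell1997-modular-forms-fermats-last-theorem p649,p660), paper:doi-10-1186-s40687-016-0074-9 p4,p25 (Darmon–Rotger 2016: classes expected in Sel precisely when ord = 2; 'testing this prediction … an interesting challenge'), CastellaHsieh2022 = arXiv:1809.09066 p4 Thm A/Cor B (non-trivial Selmer classes for rank 2, points not produced; Cor B assumes rank 2 and Ш[p^∞] finite), arXiv:2104.12575 p3 (Fornea–Gehrmann: 'long-standing open problem … construction of P ∈ ∧^r A(E) non-torsion exactly when r_alg = r'; plectic points conjectural), paper:dokchitser2010-birch-swinnerton-dyer-quotients-modulo-squares p27 Cor 4.20 (odd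 r_an ⇒ rank ≥ 1 unless Ш ⊇ ℚ/ℤ; even r_an: nothing)
First open case of LB+1 and the most informative single statement of the survey: no method
constructs even one rational point of infinite order when r_an ≥ 2 (Heegner points are torsion then,
GrossZagier1986 + Kolyvagin; Darmon's Stark–Heegner points and DarmonRotger2017 diagonal classes are
the candidate mechanisms). BirchSwinnertonDyer1965; Clay2006. imports:
Summits.BirchSwinnertonDyer.Statement,
Literature.NumberTheory.EllipticCurves.{Selmer,Sha,Heights,GaloisAction,Tamagawa,BSDInvariants}
(routes/Sketch.lean, lean check rc 0 on 2026-08-13). -/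
@[route_item "route-BirchSwinnertonDyer-Squeeze"]
def SqueezeOnePoint : Prop :=
  ∀ (W : WeierstrassCurve ℚ) [W.IsElliptic], 2 ≤ W.analyticRank → 1 ≤ W.mordellWeilRank

/-- item stmt-BirchSwinnertonDyer-0144 · crux · rank 3 · open · by planner
why it might fail: False iff some E has r_an ≥ r_MW + 2 (e.g. r_an = 2 with E(ℚ) finite and Ш infinite). Open for all r_an ≥ 2 (contains OnePoint); p-parity rescues only odd r_an and only if Ш[p^∞] is finite for some p (DD2010 Cor 4.20); a counterexample with r_an ≥ 4 is not even numerically certifiable.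
sources: Literature.NumberTheory.EllipticCurves.rank_eq_analyticRank_of_analyticRank_le_one (known part r_an ≤ 1: GrossZagier1986 Thm I.6.3, Kolyvagin1990; book:cornell1997-modular-forms-fermats-last-theorem p660 Thm 4.4), paper:dokchitser2010-birch-swinnerton-dyer-quotients-modulo-squares p27 Cor 4.20, paper:doi-10-4171-022-2-15 p13, Literature.Barriers.BirchSwinnertonDyer.NumericalVanishingBarrier (Bober2013 §1 = arXiv:1112.1503; CremonaAlgorithms1997 §2.13 p37), Literature.Barriers.BirchSwinnertonDyer.HeegnerPointBarrier
Analytic rank exceeds Mordell–Weil rank by at most one. Known when r_an ≤ 1 (GrossZagier1986 Thm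
I.6.3 + Kolyvagin1990 =
Literature.NumberTheory.EllipticCurves.rank_eq_analyticRank_of_analyticRank_le_one). imports:
Summits.BirchSwinnertonDyer.Statement,
Literature.NumberTheory.EllipticCurves.{Selmer,Sha,Heights,GaloisAction,Tamagawa,BSDInvariants}
(routes/Sketch.lean, lean check rc 0 on 2026-08-13). -/
@[route_item "route-BirchSwinnertonDyer-Squeeze", crux]
def SqueezeLBplusOne : Prop :=
  ∀ (W : WeierstrassCurve ℚ) [W.IsElliptic], W.analyticRank ≤ W.mordellWeilRank + 1

/-- item stmt-BirchSwinnertonDyer-0496 · crux · rank 4 · open · by planner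
why it might fail: False iff an excess-rank curve exists (r_MW > r_an; forced r_an ≥ 2, r_MW ≥ 3). For r_an ≥ 2 nothing bounds r_MW by the COMPLEX order: Euler systems give r_MW ≤ corank Sel_p∞ ≤ ord_T L_p (Kato Thm 18.4, Skinner–Urban), ord_T L_p ≤ ord_{s=1}L is open (PAdicOrder); PPVW2019 heuristics presuppose BSD.
sources: Kato2004 Thm 14.2(2)+Cor 14.3, Thm 18.4 (paper:doi-10-24033-ast-639 p120; Literature.NumberTheory.EllipticCurves.kato_finite_of_L_one_ne_zero, Literature.NumberTheory.EllipticCurves.kato_mordellWeilRank_le_order_padicLFunction), SkinnerUrban2014, Literature.Barriers.BirchSwinnertonDyer.SelmerRankBarrier (Literature.Barriers.BirchSwinnertonDyer.selmerRankBarrier_of_fact), book:cornell1997-modular-forms-fermats-last-theorem p658 Thm 4.1, p660 Thm 4.4 + Remark (UB known only for r_an ≤ 1, via GZ+Kolyvagin), ParkPoonenVoightWood2019 = paper:arxiv-1602.01431 p2 (heuristic assumes BSD; neutral), Literature.NumberTheory.EllipticCurves.mordellWeilRank_le_analyticRank (FunctionField.lean: UB IS a theorem over 𝔽_q(t), Tate1966Bourbaki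 — contrast, not transferable)
SUPERSEDES stmt-BirchSwinnertonDyer-0145 (r2). The old item was FALSELY closed 2026-08-13T06:58:11Z
by the gate decides-probe of p2749 as 'proved' by
Literature.EllArith.HigherGrossZagierDatum.leadingLCoeff_eq / det_ne_zero_of_leadingLCoeff_ne_zero —
lemmas taking (D : HigherGrossZagierDatum W W.analyticRank) as hypothesis, which cannot inhabit this
Prop (the same probe 'proved' both old 0145 and its negation-side 0257). Statement, rank and route
unchanged; grounder/refuter notes on stmt-BirchSwinnertonDyer-0145 remain valid and should be
copied, not redone. Upper bound: the Mordell–Weil rank never exceeds the analytic rank. Known when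
r_an ≤ 1 (Kolyvagin1990; Kato2004 Thm 14.2 for r_an = 0). Shared verbatim with HigherGrossZagier
(dedup). Its negation is Squeeze#6. imports: Summits.BirchSwinnertonDyer.Statement,
Literature.NumberTheory.EllipticCurves.{Selmer,Sha,Heights,GaloisAction,Tamagawa,BSDInvariants}
(routes/Sketch.lean, lean check rc 0 on 2026-08-13). -/
@[route_item "route-BirchSwinnertonDyer-Squeeze", crux]
def SqueezeUBR2 : Prop :=
  ∀ (W : WeierstrassCurve ℚ) [W.IsElliptic], W.mordellWeilRank ≤ W.analyticRank

/-- item stmt-BirchSwinnertonDyer-0146 · crux · rank 5 · open · by planner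
why it might fail: MW parity for E fails iff corank_{ℤp} Ш(E/ℚ)[p^∞] is odd — for one, equivalently every, p, since p-parity (DD2010 Thm 1.4) holds for all p. Nothing excludes this once r_an ≥ 2: 'BSD mod 2 or Ш ⊇ ℚ/ℤ' (Cor 4.20) is the state of the art, and no local formula reaches r_MW itself (DD2011).
sources: DokchitserDokchitserAnnals2010 Thm 1.4 (=4.19), Cor 4.20, p2 'virtually nothing is known' (paper:dokchitser2010-birch-swinnerton-dyer-quotients-modulo-squares p2,p26,p27), Literature.NumberTheory.EllipticCurves.selmerCorank_mod_two_eq + Literature.NumberTheory.EllipticCurves.even_analyticRank_iff_rootNumber_eq_one (tree facts), Literature.Barriers.BirchSwinnertonDyer.mordellWeilRank_mod_two_eq_iff_even_shaCorank (MW parity ⇔ Even (shaCorank p)), Literature.Barriers.BirchSwinnertonDyer.DokchitserDokchitser2011_rankMod_notSumOfLocalInvariants, Literature.Barriers.BirchSwinnertonDyer.SelmerRankBarrier, Nekovar2006 §12 (acq-00138, unread locally)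
Parity conjecture for the Mordell–Weil rank (not the Selmer rank): equivalent, given p-parity
(DokchitserDokchitser2010 Thm 1.4 = Literature.NumberTheory.EllipticCurves.selmerCorank_mod_two_eq)
and w(E) = (-1)^{r_an}
(Literature.NumberTheory.EllipticCurves.even_analyticRank_iff_rootNumber_eq_one), to evenness of
corank Ш[p^∞] for one p; follows from SelmerRank#5. Nekovar2006 §12. Stated without rootNumber on
purpose. imports: Summits.BirchSwinnertonDyer.Statement,
Literature.NumberTheory.EllipticCurves.{Selmer,Sha,Heights,GaloisAction,Tamagawa,BSDInvariants}
(routes/Sketch.lean, lean check rc 0 on 2026-08-13). -/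
@[route_item "route-BirchSwinnertonDyer-Squeeze", crux]
def SqueezeParity : Prop :=
  ∀ (W : WeierstrassCurve ℚ) [W.IsElliptic], Even W.mordellWeilRank ↔ Even W.analyticRank

/-- item stmt-BirchSwinnertonDyer-0492 · support · rank 0 · open · by planner
SUPERSEDES stmt-BirchSwinnertonDyer-0141 (r2). The old item was FALSELY closed 2026-08-13T06:58:11Z
by the gate decides-probe of p2749 as 'proved' by
Literature.EllArith.HigherGrossZagierDatum.leadingLCoeff_eq / det_ne_zero_of_leadingLCoeff_ne_zero —
lemmas taking (D : HigherGrossZagierDatum W W.analyticRank) as hypothesis, which cannot inhabit this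
Prop (the same probe 'proved' both old 0145 and its negation-side 0257). Statement, rank and route
unchanged; grounder/refuter notes on stmt-BirchSwinnertonDyer-0141 remain valid and should be
copied, not redone. Thesis X of route Squeeze: upper bound, lower bound up to one, and parity
agreement of Mordell–Weil and analytic ranks. Kato2004/Kolyvagin1990 (UB in r_an ≤ 1),
GrossZagier1986 (LB), DokchitserDokchitser2010 + Nekovar2006 §12 (parity). imports:
Summits.BirchSwinnertonDyer.Statement,
Literature.NumberTheory.EllipticCurves.{Selmer,Sha,Heights,GaloisAction,Tamagawa,BSDInvariants}
(routes/Sketch.lean, lean check rc 0 on 2026-08-13). -/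
@[route_item "route-BirchSwinnertonDyer-Squeeze"]
def SqueezeThesisR2 : Prop :=
  (∀ (W : WeierstrassCurve ℚ) [W.IsElliptic], W.mordellWeilRank ≤ W.analyticRank) ∧ (∀ (W : WeierstrassCurve ℚ) [W.IsElliptic], W.analyticRank ≤ W.mordellWeilRank + 1) ∧ (∀ (W : WeierstrassCurve ℚ) [W.IsElliptic], Even W.mordellWeilRank ↔ Even W.analyticRank)

/-- item stmt-BirchSwinnertonDyer-0494 · support · rank 2 · open · by planner
SUPERSEDES stmt-BirchSwinnertonDyer-0143 (r2). The old item was FALSELY closed 2026-08-13T06:58:11Z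
by the gate decides-probe of p2749 as 'proved' by
Literature.EllArith.HigherGrossZagierDatum.leadingLCoeff_eq / det_ne_zero_of_leadingLCoeff_ne_zero —
lemmas taking (D : HigherGrossZagierDatum W W.analyticRank) as hypothesis, which cannot inhabit this
Prop (the same probe 'proved' both old 0145 and its negation-side 0257). Statement, rank and route
unchanged; grounder/refuter notes on stmt-BirchSwinnertonDyer-0143 remain valid and should be
copied, not redone. First open case of LB+1 and the most informative single statement of the survey:
no method constructs even one rational point of infinite order when r_an ≥ 2 (Heegner points are
torsion then, GrossZagier1986 + Kolyvagin; Darmon's Stark–Heegner points and DarmonRotger2017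
diagonal classes are the candidate mechanisms). BirchSwinnertonDyer1965; Clay2006. imports:
Summits.BirchSwinnertonDyer.Statement,
Literature.NumberTheory.EllipticCurves.{Selmer,Sha,Heights,GaloisAction,Tamagawa,BSDInvariants}
(routes/Sketch.lean, lean check rc 0 on 2026-08-13). -/
@[route_item "route-BirchSwinnertonDyer-Squeeze"]
def SqueezeOnePointR2 : Prop :=
  ∀ (W : WeierstrassCurve ℚ) [W.IsElliptic], 2 ≤ W.analyticRank → 1 ≤ W.mordellWeilRank

/-- item stmt-BirchSwinnertonDyer-0495 · support · rank 3 · open · by planner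
SUPERSEDES stmt-BirchSwinnertonDyer-0144 (r2). The old item was FALSELY closed 2026-08-13T06:58:11Z
by the gate decides-probe of p2749 as 'proved' by
Literature.EllArith.HigherGrossZagierDatum.leadingLCoeff_eq / det_ne_zero_of_leadingLCoeff_ne_zero —
lemmas taking (D : HigherGrossZagierDatum W W.analyticRank) as hypothesis, which cannot inhabit this
Prop (the same probe 'proved' both old 0145 and its negation-side 0257). Statement, rank and route
unchanged; grounder/refuter notes on stmt-BirchSwinnertonDyer-0144 remain valid and should be
copied, not redone. Analytic rank exceeds Mordell–Weil rank by at most one. Known when r_an ≤ 1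
(GrossZagier1986 Thm I.6.3 + Kolyvagin1990 =
Literature.NumberTheory.EllipticCurves.rank_eq_analyticRank_of_analyticRank_le_one). imports:
Summits.BirchSwinnertonDyer.Statement,
Literature.NumberTheory.EllipticCurves.{Selmer,Sha,Heights,GaloisAction,Tamagawa,BSDInvariants}
(routes/Sketch.lean, lean check rc 0 on 2026-08-13). -/
@[route_item "route-BirchSwinnertonDyer-Squeeze"]
def SqueezeLBplusOneR2 : Prop :=
  ∀ (W : WeierstrassCurve ℚ) [W.IsElliptic], W.analyticRank ≤ W.mordellWeilRank + 1

/-- item stmt-BirchSwinnertonDyer-0145 · support · rank 4 · open · by planner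
why it might fail: False iff an excess-rank curve exists (r_MW > r_an; forced r_an ≥ 2, r_MW ≥ 3). For r_an ≥ 2 nothing bounds r_MW by the COMPLEX order: Euler systems give r_MW ≤ corank Sel_p∞ ≤ ord_T L_p (Kato Thm 18.4, Skinner–Urban), ord_T L_p ≤ ord_{s=1}L is open (PAdicOrder); PPVW2019 heuristics presuppose BSD.
sources: Kato2004 Thm 14.2(2)+Cor 14.3, Thm 18.4 (paper:doi-10-24033-ast-639 p120; Literature.NumberTheory.EllipticCurves.kato_finite_of_L_one_ne_zero, Literature.NumberTheory.EllipticCurves.kato_mordellWeilRank_le_order_padicLFunction), SkinnerUrban2014, Literature.Barriers.BirchSwinnertonDyer.SelmerRankBarrier (Literature.Barriers.BirchSwinnertonDyer.selmerRankBarrier_of_fact), book:cornell1997-modular-forms-fermats-last-theorem p658 Thm 4.1, p660 Thm 4.4 + Remark (UB known only for r_an ≤ 1, via GZ+Kolyvagin), ParkPoonenVoightWood2019 = paper:arxiv-1602.01431 p2 (heuristic assumes BSD; neutral), Literature.NumberTheory.EllipticCurves.mordellWeilRank_le_analyticRank (FunctionField.lean: UB IS a theorem over 𝔽_q(t), Tate1966Bourbaki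 — contrast, not transferable)
Upper bound: the Mordell–Weil rank never exceeds the analytic rank. Known when r_an ≤ 1
(Kolyvagin1990; Kato2004 Thm 14.2 for r_an = 0). Shared verbatim with HigherGrossZagier (dedup). Its
negation is Squeeze#6. imports: Summits.BirchSwinnertonDyer.Statement,
Literature.NumberTheory.EllipticCurves.{Selmer,Sha,Heights,GaloisAction,Tamagawa,BSDInvariants}
(routes/Sketch.lean, lean check rc 0 on 2026-08-13). -/
@[route_item "route-BirchSwinnertonDyer-Squeeze", crux]
def SqueezeUB : Prop :=
  ∀ (W : WeierstrassCurve ℚ) [W.IsElliptic], W.mordellWeilRank ≤ W.analyticRank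

/-- item stmt-BirchSwinnertonDyer-0497 · support · rank 5 · open · by planner
SUPERSEDES stmt-BirchSwinnertonDyer-0146 (r2). The old item was FALSELY closed 2026-08-13T06:58:11Z
by the gate decides-probe of p2749 as 'proved' by
Literature.EllArith.HigherGrossZagierDatum.leadingLCoeff_eq / det_ne_zero_of_leadingLCoeff_ne_zero —
lemmas taking (D : HigherGrossZagierDatum W W.analyticRank) as hypothesis, which cannot inhabit this
Prop (the same probe 'proved' both old 0145 and its negation-side 0257). Statement, rank and route
unchanged; grounder/refuter notes on stmt-BirchSwinnertonDyer-0146 remain valid and should be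
copied, not redone. Parity conjecture for the Mordell–Weil rank (not the Selmer rank): equivalent,
given p-parity (DokchitserDokchitser2010 Thm 1.4 =
Literature.NumberTheory.EllipticCurves.selmerCorank_mod_two_eq) and w(E) = (-1)^{r_an}
(Literature.NumberTheory.EllipticCurves.even_analyticRank_iff_rootNumber_eq_one), to evenness of
corank Ш[p^∞] for one p; follows from SelmerRank#5. Nekovar2006 §12. Stated without rootNumber on
purpose. imports: Summits.BirchSwinnertonDyer.Statement,
Literature.NumberTheory.EllipticCurves.{Selmer,Sha,Heights,GaloisAction,Tamagawa,BSDInvariants}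
(routes/Sketch.lean, lean check rc 0 on 2026-08-13). -/
@[route_item "route-BirchSwinnertonDyer-Squeeze"]
def SqueezeParityR2 : Prop :=
  ∀ (W : WeierstrassCurve ℚ) [W.IsElliptic], Even W.mordellWeilRank ↔ Even W.analyticRank

/-- item stmt-BirchSwinnertonDyer-0257 · support · rank 6 · open · by planner
why it might fail: Believed FALSE (it is ¬UB, i.e. ¬BSD): no curve with r_MW ≠ r_an is known (Cremona N_E < 500000, LMFDB); a witness needs r_an ≥ 2 (GZK) and certified L^{(m)}(E,1) ≠ 0 for some m < r_MW — finitely certifiable in principle, but no in-tree computation path (entireLFunction is choice-based).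
sources: CremonaAlgorithms1997 §2.13 (book:cremona1997-algorithms-modular-elliptic-curves-2nd-ed p37,p94), ParkPoonenVoightWood2019 (paper:arxiv-1602.01431 p2), Literature.Barriers.BirchSwinnertonDyer.NumericalVanishingBarrier (upper certification of r_an evades it; lower does not), refuter-refute-pool-5 note on 0498 (no in-tree computation path)
Negation of Squeeze#4, filed so the refutation arm is staffed. If true it is certifiable by finite
computation: exhibit k independent points (exact; HigherGrossZagier#5) and certify L^{(m)}(E,1) ≠ 0
for some m < k by interval arithmetic on the modular L-series (BCDT2001; Cremona1997 §2.13).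
Cremona's tables (N_E < 500000) contain no such curve. ParkPoonenVoightWood2019 for rank heuristics.
imports: Summits.BirchSwinnertonDyer.Statement,
Literature.NumberTheory.EllipticCurves.{Selmer,Sha,Heights,GaloisAction,Tamagawa,BSDInvariants}
(routes/Sketch.lean, lean check rc 0 on 2026-08-13). -/
@[route_item "route-BirchSwinnertonDyer-Squeeze"]
def SqueezeNegExcessRank : Prop :=
  ∃ (W : WeierstrassCurve ℚ), W.IsElliptic ∧ W.analyticRank < W.mordellWeilRank

/-- item stmt-BirchSwinnertonDyer-0498 · support · rank 6 · open · by planner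
SUPERSEDES stmt-BirchSwinnertonDyer-0257 (r2). The old item was FALSELY closed 2026-08-13T06:58:11Z
by the gate decides-probe of p2749 as 'proved' by
Literature.EllArith.HigherGrossZagierDatum.leadingLCoeff_eq / det_ne_zero_of_leadingLCoeff_ne_zero —
lemmas taking (D : HigherGrossZagierDatum W W.analyticRank) as hypothesis, which cannot inhabit this
Prop (the same probe 'proved' both old 0145 and its negation-side 0257). Statement, rank and route
unchanged; grounder/refuter notes on stmt-BirchSwinnertonDyer-0257 remain valid and should be
copied, not redone. Negation of Squeeze#4, filed so the refutation arm is staffed. If true it is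
certifiable by finite computation: exhibit k independent points (exact; HigherGrossZagier#5) and
certify L^{(m)}(E,1) ≠ 0 for some m < k by interval arithmetic on the modular L-series (BCDT2001;
Cremona1997 §2.13). Cremona's tables (N_E < 500000) contain no such curve. ParkPoonenVoightWood2019
for rank heuristics. imports: Summits.BirchSwinnertonDyer.Statement,
Literature.NumberTheory.EllipticCurves.{Selmer,Sha,Heights,GaloisAction,Tamagawa,BSDInvariants}
(routes/Sketch.lean, lean check rc 0 on 2026-08-13). -/
@[route_item "route-BirchSwinnertonDyer-Squeeze"]
def SqueezeNegExcessRankR2 : Prop :=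
  ∃ (W : WeierstrassCurve ℚ), W.IsElliptic ∧ W.analyticRank < W.mordellWeilRank

/-- item stmt-BirchSwinnertonDyer-1068 · support · rank 9 · open · by planner
[support] needs-fact: WeierstrassCurve.hasEntireLFunction_rat
(Literature/NumberTheory/EllipticCurves/AnalyticRank.lean:176) — for every elliptic E/ℚ, L(E,s) = Σ
aₙ n⁻ˢ extends to an entire function (Wiles1995; BCDTJAMS2001 Thm A + Hecke; SilvermanAEC2009 Thm
C.16.3). The route's ONLY unproved cone fact and its standing hypothesis hE:
WeierstrassCurve.analyticRank := analyticOrderNatAt W.entireLFunction 1 is a junk value without it,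
and it enters the import cone through Summits/BirchSwinnertonDyer/BirchSwinnertonDyer/Statement.lean
itself, so no route of the summit can be stated around it. Tier-0 literature debt, already reduced
in tree to the modularity fact
Literature.NumberTheory.EllipticCurves.ModularForms.exists_isNewformOf
(WeierstrassCurve.hasEntireLFunction_rat_of_exists_isNewformOf,
AnalyticRankModularityProofs.lean:209, kernel-clean: propext/Classical.choice/Quot.sound); what
remains is the Modularity Theorem itself (XL; no formalisation exists). First antecedent of
Assembly; every other item of the route carries it as hypothesis. Closes by `theorem … :
EntireContinuation := WeierstrassCurve.hasEntireLFunction_rat_holds` once that lands. Not a crux: a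
theorem in print; pr -/
@[route_item "route-BirchSwinnertonDyer-Squeeze"]
def EntireContinuation : Prop :=
  ∀ (W : WeierstrassCurve ℚ) [W.IsElliptic], W.HasEntireLFunction

/-- item stmt-BirchSwinnertonDyer-14214 · support · rank 9 · open · by planner
[support] glue Crux… → target (route.target-unreachable repair, route-choice 2026-08-16): the three
ranked cruxes UB (SqueezeUBR2), LB+1 (SqueezeLBplusOne) and PAR (SqueezeParity) give the target X =
SqueezeThesis, whose conjuncts are these decls' bodies verbatim — conjunction introduction, provable
now in one line (planner Sketch.lean, lean check rc 0). Routine bookkeeping, not a crux; no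
Literature fact needed. With the certified deciding theorem closes : SqueezeUBR2 → SqueezeLBplusOne
→ SqueezeParity → BirchSwinnertonDyer, target and Statement close as soon as the three cruxes do. -/
@[route_item "route-BirchSwinnertonDyer-Squeeze"]
def SqueezeThesisOfCruxes : Prop :=
  SqueezeUBR2 → SqueezeLBplusOne → SqueezeParity → SqueezeThesis

/-- item stmt-BirchSwinnertonDyer-0142 · assembly · rank 1 · closed · proved by Literature.BSD.squeeze_assembly (refuter) · by planner
a ≤ b ≤ a+1 with a, b of equal parity forces a = b; unfold BirchSwinnertonDyer =
Literature.BSDRankConjecture. No facts needed. Provable now. imports: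
Summits.BirchSwinnertonDyer.Statement,
Literature.NumberTheory.EllipticCurves.{Selmer,Sha,Heights,GaloisAction,Tamagawa,BSDInvariants}
(routes/Sketch.lean, lean check rc 0 on 2026-08-13). -/
@[route_item "route-BirchSwinnertonDyer-Squeeze"]
def Assembly : Prop :=
  ((∀ (W : WeierstrassCurve ℚ) [W.IsElliptic], W.mordellWeilRank ≤ W.analyticRank) ∧ (∀ (W : WeierstrassCurve ℚ) [W.IsElliptic], W.analyticRank ≤ W.mordellWeilRank + 1) ∧ (∀ (W : WeierstrassCurve ℚ) [W.IsElliptic], Even W.mordellWeilRank ↔ Even W.analyticRank)) → BirchSwinnertonDyer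

/-- `Assembly` holds: proved by `Literature.BSD.squeeze_assembly`. -/
theorem Assembly_holds : Assembly := _root_.Literature.BSD.squeeze_assembly

-- records of items no longer active in this route (dropped / restated):
-- earlier Assembly2 (stmt-BirchSwinnertonDyer-0493, dropped 2026-08-16T14:43:05Z): proved by Literature.BSD.squeeze_assembly — ((∀ (W : WeierstrassCurve ℚ) [W.IsElliptic], W.mordellWeilRank ≤ W.analyticRank) ∧ (∀ (W : WeierstrassCurve ℚ) [W.IsElliptic], W.analyticRank ≤ W.mordellWeilRank + 1) ∧ (∀ (W : WeierstrassCurve ℚ) [W.IsElliptic], Even W.mordellWeilRank ↔ Even W.analyticRank)) → BirchSwinnert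

/-! D-0027 §2.1 — DECIDING THEOREM (planner-authored via `route open/edit --closes-file`; by planner-rchoice-BirchSwinnertonDyer-Squeeze-ha-e7e34bb0-0 2026-08-15T18:12:08Z):
its hypotheses are this route's items and its conclusion the sub-problem Statement (glue_lint), and it elaborates with this file. -/

@[closes "route-BirchSwinnertonDyer-Squeeze"] theorem closes (hUB : SqueezeUBR2) (hLB : SqueezeLBplusOne) (hPAR : SqueezeParity) :
    _root_.BirchSwinnertonDyer := by
  -- BirchSwinnertonDyer := Literature.BSDRankConjecture := ∀ W, W.IsElliptic → r_an W = r_MW W.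
  intro W hW
  have h₁ : W.mordellWeilRank ≤ W.analyticRank := @hUB W hW
  have h₂ : W.analyticRank ≤ W.mordellWeilRank + 1 := @hLB W hW
  have h₃ : W.mordellWeilRank % 2 = 0 ↔ W.analyticRank % 2 = 0 := by
    simpa only [Nat.even_iff] using @hPAR W hW
  -- a ≤ b ≤ a + 1 with a ≡ b (mod 2) forces b = a
  omega

end Summit.BirchSwinnertonDyer.BirchSwinnertonDyer.Theses.Squeeze
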